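import Literature.AlgebraicGeometry.Resolution.BlowupDisjointCentreWeights
import Literature.AlgebraicGeometry.Resolution.BlowupRestrictOpen
import HarnessLib

/-!
# Splitting a blowing up along a disconnected centre, III: transport of pointwise data to the lifted piece
# (max-weight clauses, strict transforms, supports, orders everywhere on the piece, the generic point)

Topic: `Literature/AlgebraicGeometry/Resolution`. Third file of the «peeling» kit (I = `BlowupDisjointCentreSplitting`,
II = `BlowupDisjointCentreWeights`): `τ₁ : E₁ → E′` is a blowing up along `P` (universal property, Görtz–Wedhorn I
Def. 13.90) and `Q` is a second ideal sheaf with `V(P) ∩ V(Q) = ∅`, so that `τ₁` is an isomorphism over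
`E′ ∖ V(P) ⊇ V(Q)` (Görtz–Wedhorn I, Prop. 13.91 (3) = Stacks 02OS) and the lifted piece is `V(Q 𝒪_{E₁}) = τ₁⁻¹V(Q)`.
A WEIGHTED blow-up sequence that blows up a disconnected regular centre piece by piece (Bierstone–Grigoriev–
Milman–Włodarczyk 2011, §3.2 and §4 Step 2b; the E-side driver of cell res-hironaka's chain W5.2, T5-E) carries
three kinds of POINTWISE data of the not-yet-blown-up piece `V(Q)` across `τ₁`; this file proves they are unchanged:

* containments between stalks and powers of stalks (`stalkIdeal_comap_le_pow_iff_of_mem_support_of_disjoint`,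
  `…controlledTransform…`): at `y` over `V(Q)`, `(τ₁ᶜ(𝔟, b))_y ⊆ (Q𝒪_{E₁})_yⁿ ↔ 𝔟_{τ₁ y} ⊆ Q_{τ₁ y}ⁿ` — so the
  pointwise MAX-WEIGHT clause «`𝔟_z ⊄ Q_zⁿ` at every `z ∈ V(Q)`» holds for `(τ₁ᶜ(𝔟, b), Q𝒪_{E₁})` iff it holds
  for `(𝔟, Q)` (`forall_not_stalkIdeal_controlledTransform_le_pow_iff_of_disjoint`);
* «for every point of the piece» statements transfer both ways (`forall_mem_support_comap_iff_of_disjoint`, from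
  II's surjectivity `IsBlowup.image_support_comap_of_disjoint`), e.g. «`m ≤ ord_y` at every point of the piece»
  (`forall_le_idealOrder_controlledTransform_iff_of_disjoint`) — the datum defining the max-weight of a piece;
* strict transforms over `V(Q)` are total transforms (`stalkIdeal_strictTransformIdeal_of_mem_support_of_disjoint`,
  `…_eq_stalkIdeal_controlledTransform…`), supports over `V(Q)` are preimages
  (`mem_support_controlledTransform_iff_of_mem_support_of_disjoint`, `…strictTransformIdeal…`);
* THE GENERIC POINT LIFTS (`exists_isGenericPoint_support_comap_of_disjoint`): if `η` is the generic point of the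
  irreducible `V(Q)` then `τ₁⁻¹V(Q)` (irreducible by II) has a generic point `η₁` with `τ₁ η₁ = η`, at which
  `ord_{η₁} τ₁ᶜ(𝔟, b) = ord_η 𝔟` (`idealOrder_controlledTransform_genericPoint_of_disjoint`).

Everything is proved over the tree's carriers (no definitions, no sorry); the pointwise mechanism is the stalk
isomorphism `𝒪_{E′, τ₁ y} ≅ 𝒪_{E₁, y}` (II) fed into the iso-stalk-map dictionary of `BlowupRestrictOpen.lean`.
Written for cell res-hironaka (crux `PatchingRelPerfect`, chain W5.2, brick (L-B) part 2 for res-D-pv-054's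
Phase-A transport with boundary) by res-type-002; generic.

## Sources
* U. Görtz, T. Wedhorn, *Algebraic Geometry I* (2nd ed. 2020), Def. 13.90, Prop. 13.91 (3) p. 414. [GortzWedhorn2020]
* E. Bierstone, D. Grigoriev, P. Milman, J. Włodarczyk, arXiv:1206.3090, §3.2, Lemma 3.2.1, Lemma 8.0.3 (2),
  Thm. 8.0.5, §4 Step 2b. [BierstoneGrigorievMilmanWlodarczyk2011]
* The Stacks Project, Tag 02OS. [StacksProject]
-/

noncomputable section

open CategoryTheory CategoryTheory.Limits AlgebraicGeometry TopologicalSpace IsLocalRing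

namespace Literature.AlgebraicGeometry.Resolution

universe u

open Scheme.IdealSheafData

variable {E' E₁ : Scheme.{u}} {τ₁ : E₁ ⟶ E'} {P Q : E'.IdealSheafData}

/-! ## §1 Stalk containments at points over the second piece -/

/-- **At a point `y` over `V(Q)`, `(I𝒪_{E₁})_y ⊆ (J𝒪_{E₁})_yⁿ ↔ I_{τ₁ y} ⊆ J_{τ₁ y}ⁿ`** (the stalk map of `τ₁` at
`y` is an isomorphism, Görtz–Wedhorn I Prop. 13.91 (3); containments are preserved and reflected, BGMW
Lemma 8.0.3 (2)). [cite: BierstoneGrigorievMilmanWlodarczyk2011, Lemma 8.0.3 (2)] -/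
theorem IsBlowup.stalkIdeal_comap_le_pow_iff_of_mem_support_of_disjoint (hτ₁ : IsBlowup τ₁ P)
    (hd : Disjoint (P.support : Set E') (Q.support : Set E')) (I J : E'.IdealSheafData) {y : E₁}
    (hy : τ₁ y ∈ (Q.support : Set E')) (n : ℕ) :
    stalkIdeal (I.comap τ₁) y ≤ stalkIdeal (J.comap τ₁) y ^ n ↔ stalkIdeal I (τ₁ y) ≤ stalkIdeal J (τ₁ y) ^ n := by
  haveI := hτ₁.isIso_stalkMap_of_mem_support_of_disjoint hd hy
  exact stalkIdeal_comap_le_pow_iff_of_isIso_stalkMap τ₁ I J y n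

/-- **The controlled transform against the lifted piece**: at `y` over `V(Q)`,
`(τ₁ᶜ(𝔟, b))_y ⊆ (Q𝒪_{E₁})_yⁿ ↔ 𝔟_{τ₁ y} ⊆ Q_{τ₁ y}ⁿ` (over `V(Q)` the controlled transform is the total
transform, II). [cite: BierstoneGrigorievMilmanWlodarczyk2011, §3.2 with Lemma 8.0.3 (2)] -/
theorem IsBlowup.stalkIdeal_controlledTransform_le_pow_iff_of_mem_support_of_disjoint (hτ₁ : IsBlowup τ₁ P)
    (hd : Disjoint (P.support : Set E') (Q.support : Set E')) (𝔟 : E'.IdealSheafData) (b : ℕ) {y : E₁}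
    (hy : τ₁ y ∈ (Q.support : Set E')) (n : ℕ) :
    stalkIdeal (controlledTransform τ₁ P 𝔟 b) y ≤ stalkIdeal (Q.comap τ₁) y ^ n ↔
      stalkIdeal 𝔟 (τ₁ y) ≤ stalkIdeal Q (τ₁ y) ^ n := by
  rw [hτ₁.stalkIdeal_controlledTransform_of_mem_support_of_disjoint hd 𝔟 b hy]
  exact hτ₁.stalkIdeal_comap_le_pow_iff_of_mem_support_of_disjoint hd 𝔟 Q hy n

/-- The same against the maximal ideal: `(τ₁ᶜ(𝔟, b))_y ⊆ 𝔪_yⁿ ↔ 𝔟_{τ₁ y} ⊆ 𝔪_{τ₁ y}ⁿ` at `y` over `V(Q)`.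
[cite: BierstoneGrigorievMilmanWlodarczyk2011, Lemma 8.0.3 (2)] -/
theorem IsBlowup.stalkIdeal_controlledTransform_le_maximalIdeal_pow_iff_of_mem_support_of_disjoint
    (hτ₁ : IsBlowup τ₁ P) (hd : Disjoint (P.support : Set E') (Q.support : Set E')) (𝔟 : E'.IdealSheafData)
    (b : ℕ) {y : E₁} (hy : τ₁ y ∈ (Q.support : Set E')) (n : ℕ) :
    stalkIdeal (controlledTransform τ₁ P 𝔟 b) y ≤ maximalIdeal (E₁.presheaf.stalk y) ^ n ↔
      stalkIdeal 𝔟 (τ₁ y) ≤ maximalIdeal (E'.presheaf.stalk (τ₁ y)) ^ n := by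
  haveI := hτ₁.isIso_stalkMap_of_mem_support_of_disjoint hd hy
  rw [hτ₁.stalkIdeal_controlledTransform_of_mem_support_of_disjoint hd 𝔟 b hy]
  exact stalkIdeal_comap_le_maximalIdeal_pow_iff_of_isIso_stalkMap τ₁ 𝔟 y n

/-! ## §2 «At every point of the piece» transfers both ways -/

/-- **Quantifiers over the lifted piece = quantifiers over the piece**: `τ₁` maps `V(Q𝒪_{E₁})` ONTO `V(Q)` (II,
`IsBlowup.image_support_comap_of_disjoint`), so a property of points of `E′` holds at `τ₁ y` for every `y` over
`V(Q)` iff it holds at every point of `V(Q)`. [cite: GortzWedhorn2020, Prop. 13.91 (3) p. 414] -/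
theorem IsBlowup.forall_mem_support_comap_iff_of_disjoint (hτ₁ : IsBlowup τ₁ P)
    (hd : Disjoint (P.support : Set E') (Q.support : Set E')) (R : E' → Prop) :
    (∀ y ∈ ((Q.comap τ₁).support : Set E₁), R (τ₁ y)) ↔ ∀ z ∈ (Q.support : Set E'), R z := by
  constructor
  · intro h z hz
    rw [← hτ₁.image_support_comap_of_disjoint hd] at hz
    obtain ⟨y, hy, rfl⟩ := hz
    exact h y hy
  · intro h y hy
    exact h _ ((mem_support_comap_iff τ₁ Q y).mp hy)

/-- **The pointwise MAX-WEIGHT clause is invariant**: «`(τ₁ᶜ(𝔟, b))_y ⊄ (Q𝒪_{E₁})_yⁿ` at every point `y` of the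
lifted piece» iff «`𝔟_z ⊄ Q_zⁿ` at every point `z` of the piece» (the clause of a weighted blow-up sequence saying
that the weight of the piece is maximal survives the blowing up of the other pieces).
[cite: BierstoneGrigorievMilmanWlodarczyk2011, §3.2 with Lemma 3.2.1] -/
theorem IsBlowup.forall_not_stalkIdeal_controlledTransform_le_pow_iff_of_disjoint (hτ₁ : IsBlowup τ₁ P)
    (hd : Disjoint (P.support : Set E') (Q.support : Set E')) (𝔟 : E'.IdealSheafData) (b n : ℕ) :
    (∀ y ∈ ((Q.comap τ₁).support : Set E₁),
        ¬ stalkIdeal (controlledTransform τ₁ P 𝔟 b) y ≤ stalkIdeal (Q.comap τ₁) y ^ n) ↔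
      ∀ z ∈ (Q.support : Set E'), ¬ stalkIdeal 𝔟 z ≤ stalkIdeal Q z ^ n := by
  rw [← hτ₁.forall_mem_support_comap_iff_of_disjoint hd]
  refine forall₂_congr fun y hy => ?_
  rw [hτ₁.stalkIdeal_controlledTransform_le_pow_iff_of_mem_support_of_disjoint hd 𝔟 b
    ((mem_support_comap_iff τ₁ Q y).mp hy) n]

/-- One direction, as consumed: the MAX-WEIGHT clause downstairs gives it upstairs.
[cite: BierstoneGrigorievMilmanWlodarczyk2011, §3.2 with Lemma 3.2.1] -/
theorem IsBlowup.not_stalkIdeal_controlledTransform_le_pow_of_disjoint (hτ₁ : IsBlowup τ₁ P)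
    (hd : Disjoint (P.support : Set E') (Q.support : Set E')) {𝔟 : E'.IdealSheafData} (b : ℕ) {n : ℕ}
    (h : ∀ z ∈ (Q.support : Set E'), ¬ stalkIdeal 𝔟 z ≤ stalkIdeal Q z ^ n) {y : E₁}
    (hy : y ∈ ((Q.comap τ₁).support : Set E₁)) :
    ¬ stalkIdeal (controlledTransform τ₁ P 𝔟 b) y ≤ stalkIdeal (Q.comap τ₁) y ^ n :=
  (hτ₁.forall_not_stalkIdeal_controlledTransform_le_pow_iff_of_disjoint hd 𝔟 b n).mpr h y hy

/-- **Orders of the controlled transform at points over the piece** (II / `BlowupOffCentre`, restated in the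
membership currency `y ∈ V(Q𝒪_{E₁})`): `ord_y τ₁ᶜ(𝔟, b) = ord_{τ₁ y} 𝔟`.
[cite: BierstoneGrigorievMilmanWlodarczyk2011, Lemma 8.0.3 (2) with §3.2] -/
theorem IsBlowup.idealOrder_controlledTransform_of_mem_support_comap_of_disjoint (hτ₁ : IsBlowup τ₁ P)
    (hd : Disjoint (P.support : Set E') (Q.support : Set E')) (𝔟 : E'.IdealSheafData) (b : ℕ) {y : E₁}
    (hy : y ∈ ((Q.comap τ₁).support : Set E₁)) :
    idealOrder (controlledTransform τ₁ P 𝔟 b) y = idealOrder 𝔟 (τ₁ y) :=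
  hτ₁.idealOrder_controlledTransform_of_not_mem 𝔟 b
    (not_mem_support_of_mem_of_disjoint hd ((mem_support_comap_iff τ₁ Q y).mp hy))

/-- **«`m ≤ ord` at every point of the piece» is invariant** — the datum deciding the (maximal) weight of the piece:
`(∀ y ∈ V(Q𝒪_{E₁}), m ≤ ord_y τ₁ᶜ(𝔟, b)) ↔ (∀ z ∈ V(Q), m ≤ ord_z 𝔟)`.
[cite: BierstoneGrigorievMilmanWlodarczyk2011, Lemma 8.0.3 (2) with Def. 3.1.3 (1)] -/
theorem IsBlowup.forall_le_idealOrder_controlledTransform_iff_of_disjoint (hτ₁ : IsBlowup τ₁ P)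
    (hd : Disjoint (P.support : Set E') (Q.support : Set E')) (𝔟 : E'.IdealSheafData) (b : ℕ) (m : ℕ∞) :
    (∀ y ∈ ((Q.comap τ₁).support : Set E₁), m ≤ idealOrder (controlledTransform τ₁ P 𝔟 b) y) ↔
      ∀ z ∈ (Q.support : Set E'), m ≤ idealOrder 𝔟 z := by
  rw [← hτ₁.forall_mem_support_comap_iff_of_disjoint hd]
  refine forall₂_congr fun y hy => ?_
  rw [hτ₁.idealOrder_controlledTransform_of_mem_support_comap_of_disjoint hd 𝔟 b hy]

/-- **Containment in a power of the lifted piece, pointwise criterion**: `τ₁ᶜ(𝔟, b) ⊆ (Q𝒪_{E₁})ⁿ` iff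
`𝔟_z ⊆ Q_zⁿ` at every `z ∈ V(Q)` (off `V(Q𝒪_{E₁})` the right-hand power is the unit ideal; over it, §1). The
global form `𝔟 ⊆ Qⁿ ⇒ τ₁ᶜ(𝔟, b) ⊆ (Q𝒪_{E₁})ⁿ` is II's `IsBlowup.controlledTransform_le_pow_comap_of_disjoint`.
[cite: BierstoneGrigorievMilmanWlodarczyk2011, §3.2 with Lemma 3.2.1 (2)] -/
theorem IsBlowup.controlledTransform_le_pow_comap_iff_of_disjoint (hτ₁ : IsBlowup τ₁ P)
    (hd : Disjoint (P.support : Set E') (Q.support : Set E')) (𝔟 : E'.IdealSheafData) (b n : ℕ) :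
    controlledTransform τ₁ P 𝔟 b ≤ Q.comap τ₁ ^ n ↔
      ∀ z ∈ (Q.support : Set E'), stalkIdeal 𝔟 z ≤ stalkIdeal Q z ^ n := by
  rw [← hτ₁.forall_mem_support_comap_iff_of_disjoint hd]
  constructor
  · intro h y hy
    rw [← hτ₁.stalkIdeal_controlledTransform_le_pow_iff_of_mem_support_of_disjoint hd 𝔟 b
      ((mem_support_comap_iff τ₁ Q y).mp hy) n, ← stalkIdeal_pow]
    exact stalkIdeal_mono h y
  · intro h
    refine le_of_forall_stalkIdeal_le fun y => ?_
    by_cases hy : y ∈ ((Q.comap τ₁).support : Set E₁)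
    · rw [stalkIdeal_pow, hτ₁.stalkIdeal_controlledTransform_le_pow_iff_of_mem_support_of_disjoint hd 𝔟 b
        ((mem_support_comap_iff τ₁ Q y).mp hy) n]
      exact h y hy
    · rw [stalkIdeal_pow, stalkIdeal_eq_top_of_not_mem_support hy, Ideal.top_pow]
      exact le_top

/-! ## §3 Strict transforms and supports over the second piece -/

/-- **Over `V(Q)` the strict transform of `V(K)` is the total transform**: `(σ(K))_y = (K𝒪_{E₁})_y` at `y` over
`V(Q)` (Görtz–Wedhorn I (13.19): off the centre the saturation does nothing; tree
`IsBlowup.stalkIdeal_strictTransformIdeal_of_not_mem` in the disjoint-piece currency).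
[cite: GortzWedhorn2020, (13.19) p. 414] -/
theorem IsBlowup.stalkIdeal_strictTransformIdeal_of_mem_support_of_disjoint [IsLocallyNoetherian E']
    [IsLocallyNoetherian E₁] (hτ₁ : IsBlowup τ₁ P) (hd : Disjoint (P.support : Set E') (Q.support : Set E'))
    (K : E'.IdealSheafData) {y : E₁} (hy : τ₁ y ∈ (Q.support : Set E')) :
    stalkIdeal (strictTransformIdeal τ₁ P K) y = stalkIdeal (K.comap τ₁) y :=
  hτ₁.stalkIdeal_strictTransformIdeal_of_not_mem K (not_mem_support_of_mem_of_disjoint hd hy)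

/-- Over `V(Q)` the strict and the controlled transforms have the same stalks (both are the total transform).
[cite: BierstoneGrigorievMilmanWlodarczyk2011, §3.2] -/
theorem IsBlowup.stalkIdeal_strictTransformIdeal_eq_stalkIdeal_controlledTransform_of_disjoint
    [IsLocallyNoetherian E'] [IsLocallyNoetherian E₁] (hτ₁ : IsBlowup τ₁ P)
    (hd : Disjoint (P.support : Set E') (Q.support : Set E')) (K : E'.IdealSheafData) (b : ℕ) {y : E₁}
    (hy : τ₁ y ∈ (Q.support : Set E')) :
    stalkIdeal (strictTransformIdeal τ₁ P K) y = stalkIdeal (controlledTransform τ₁ P K b) y := by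
  rw [hτ₁.stalkIdeal_strictTransformIdeal_of_mem_support_of_disjoint hd K hy,
    hτ₁.stalkIdeal_controlledTransform_of_mem_support_of_disjoint hd K b hy]

/-- **The strict transform against the lifted piece**: at `y` over `V(Q)`, `(σ(K))_y ⊆ (Q𝒪_{E₁})_yⁿ ↔
K_{τ₁ y} ⊆ Q_{τ₁ y}ⁿ`. [cite: BierstoneGrigorievMilmanWlodarczyk2011, Lemma 8.0.3 (2)] -/
theorem IsBlowup.stalkIdeal_strictTransformIdeal_le_pow_iff_of_mem_support_of_disjoint [IsLocallyNoetherian E']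
    [IsLocallyNoetherian E₁] (hτ₁ : IsBlowup τ₁ P) (hd : Disjoint (P.support : Set E') (Q.support : Set E'))
    (K : E'.IdealSheafData) {y : E₁} (hy : τ₁ y ∈ (Q.support : Set E')) (n : ℕ) :
    stalkIdeal (strictTransformIdeal τ₁ P K) y ≤ stalkIdeal (Q.comap τ₁) y ^ n ↔
      stalkIdeal K (τ₁ y) ≤ stalkIdeal Q (τ₁ y) ^ n := by
  rw [hτ₁.stalkIdeal_strictTransformIdeal_of_mem_support_of_disjoint hd K hy]
  exact hτ₁.stalkIdeal_comap_le_pow_iff_of_mem_support_of_disjoint hd K Q hy n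

/-- A point lies in the support of an ideal sheaf iff the stalk is contained in the maximal ideal (`= 𝔪¹`).
[folklore] -/
private theorem mem_support_iff_stalkIdeal_le_pow_one {X : Scheme.{u}} (I : X.IdealSheafData) (x : X) :
    x ∈ (I.support : Set X) ↔ stalkIdeal I x ≤ maximalIdeal (X.presheaf.stalk x) ^ 1 := by
  rw [pow_one]
  exact mem_support_iff_stalkIdeal_le I x

/-- **Supports over the piece are preimages**: at `y` over `V(Q)`, `y ∈ Supp τ₁ᶜ(𝔟, b) ↔ τ₁ y ∈ Supp 𝔟`.
[cite: BierstoneGrigorievMilmanWlodarczyk2011, Thm. 8.0.5 with Def. 3.1.2] -/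
theorem IsBlowup.mem_support_controlledTransform_iff_of_mem_support_of_disjoint (hτ₁ : IsBlowup τ₁ P)
    (hd : Disjoint (P.support : Set E') (Q.support : Set E')) (𝔟 : E'.IdealSheafData) (b : ℕ) {y : E₁}
    (hy : τ₁ y ∈ (Q.support : Set E')) :
    y ∈ ((controlledTransform τ₁ P 𝔟 b).support : Set E₁) ↔ τ₁ y ∈ (𝔟.support : Set E') := by
  rw [mem_support_iff_stalkIdeal_le_pow_one, mem_support_iff_stalkIdeal_le_pow_one,
    hτ₁.stalkIdeal_controlledTransform_le_maximalIdeal_pow_iff_of_mem_support_of_disjoint hd 𝔟 b hy 1]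

/-- The same for the strict transform: at `y` over `V(Q)`, `y ∈ Supp σ(K) ↔ τ₁ y ∈ Supp K`.
[cite: GortzWedhorn2020, (13.19) p. 414] -/
theorem IsBlowup.mem_support_strictTransformIdeal_iff_of_mem_support_of_disjoint [IsLocallyNoetherian E']
    [IsLocallyNoetherian E₁] (hτ₁ : IsBlowup τ₁ P) (hd : Disjoint (P.support : Set E') (Q.support : Set E'))
    (K : E'.IdealSheafData) {y : E₁} (hy : τ₁ y ∈ (Q.support : Set E')) :
    y ∈ ((strictTransformIdeal τ₁ P K).support : Set E₁) ↔ τ₁ y ∈ (K.support : Set E') := by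
  rw [← hτ₁.mem_support_controlledTransform_iff_of_mem_support_of_disjoint hd K 0 hy,
    mem_support_iff_stalkIdeal_le_pow_one, mem_support_iff_stalkIdeal_le_pow_one,
    hτ₁.stalkIdeal_strictTransformIdeal_eq_stalkIdeal_controlledTransform_of_disjoint hd K 0 hy]

/-! ## §4 The generic point of the piece lifts -/

/-- **The generic point of the piece lifts**: if `η` is a generic point of `V(Q)` (so `V(Q)` is irreducible) then
the lifted piece `V(Q𝒪_{E₁}) = τ₁⁻¹V(Q)` — irreducible by II — has a generic point `η₁` with `τ₁ η₁ = η` (schemes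
are quasi-sober; `τ₁ η₁` is a generic point of `cl τ₁(V(Q𝒪_{E₁})) = V(Q)`, and generic points are unique).
[cite: GortzWedhorn2020, Prop. 13.91 (3) p. 414] -/
theorem IsBlowup.exists_isGenericPoint_support_comap_of_disjoint (hτ₁ : IsBlowup τ₁ P)
    (hd : Disjoint (P.support : Set E') (Q.support : Set E')) {η : E'}
    (hη : IsGenericPoint η (Q.support : Set E')) :
    ∃ η₁ : E₁, IsGenericPoint η₁ ((Q.comap τ₁).support : Set E₁) ∧ τ₁ η₁ = η := by
  have hirr : IsIrreducible ((Q.comap τ₁).support : Set E₁) :=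
    hτ₁.isIrreducible_support_comap_of_disjoint hd hη.isIrreducible
  obtain ⟨η₁, hη₁⟩ := QuasiSober.sober hirr (Q.comap τ₁).support.isClosed
  refine ⟨η₁, hη₁, ?_⟩
  have h1 : IsGenericPoint (τ₁ η₁) (closure (τ₁ '' ((Q.comap τ₁).support : Set E₁))) :=
    hη₁.image τ₁.continuous
  rw [hτ₁.image_support_comap_of_disjoint hd, Q.support.isClosed.closure_eq] at h1
  exact h1.eq hη

/-- **Orders at the lifted generic point**: with `η₁` as above, `ord_{η₁} τ₁ᶜ(𝔟, b) = ord_η 𝔟` — the generic order of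
`𝔟` along the piece is unchanged. [cite: BierstoneGrigorievMilmanWlodarczyk2011, Lemma 8.0.3 (2) with §3.2] -/
theorem IsBlowup.idealOrder_controlledTransform_genericPoint_of_disjoint (hτ₁ : IsBlowup τ₁ P)
    (hd : Disjoint (P.support : Set E') (Q.support : Set E')) (𝔟 : E'.IdealSheafData) (b : ℕ) {η : E'} {η₁ : E₁}
    (hη₁ : IsGenericPoint η₁ ((Q.comap τ₁).support : Set E₁)) (hη : τ₁ η₁ = η) :
    idealOrder (controlledTransform τ₁ P 𝔟 b) η₁ = idealOrder 𝔟 η := by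
  rw [← hη]
  exact hτ₁.idealOrder_controlledTransform_of_mem_support_comap_of_disjoint hd 𝔟 b hη₁.mem

/-- Every point of the lifted piece is a specialization of the lifted generic point (so pointwise conclusions drawn
«along `η ⤳ z`» downstairs are drawn along `η₁ ⤳ y` upstairs). [folklore: generic points specialize to every
point of their closure] [cite: GortzWedhorn2020, Prop. 13.91 (3) p. 414] -/
theorem IsBlowup.genericPoint_specializes_of_mem_support_comap {η₁ y : E₁}
    (hη₁ : IsGenericPoint η₁ ((Q.comap τ₁).support : Set E₁)) (hy : y ∈ ((Q.comap τ₁).support : Set E₁)) :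
    η₁ ⤳ y :=
  hη₁.specializes hy

end Literature.AlgebraicGeometry.Resolution

end
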